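import Mathlib
import Literature.Computability.AlgebraicComplexity.ArithCircuit
import Literature.Computability.AlgebraicComplexity.ArithCircuitProofs
import Literature.Computability.AlgebraicComplexity.StandardFamilies
import Literature.Computability.AlgebraicComplexity.StandardFamiliesProofs
import Literature.Computability.AlgebraicComplexity.BurgisserBooleanParts
import Literature.Computability.AlgebraicComplexity.BurgisserBooleanPartsA3Steps
import Literature.Computability.AlgebraicComplexity.CircuitCoeffIdeal
import HarnessLib

/-!
# LangWeilTransfer, item `Assembly` (stmt-ValiantsHypothesis-6382) — counting preliminaries

Route `LangWeilTransfer` of `ValiantsHypothesis`. The assembly feeds the coefficient system of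
the integer skeleton of a circuit for `per_n` (`circuitCoeffIdeal`, `circuitCoeffSupport` of
`CircuitCoeffIdeal.lean`) to the crux `TameTransfer`, whose output bound is polynomial in the
logarithm of the NUMBER `t` of generators, of their degree `d` and of the double logarithm of their
weight `w`. This file supplies the elementary counting that makes those logarithms polynomial in
`n` and the size `s` of the circuit, plus the trivial circuit for small `n`:

* `card_support_le_of_totalDegree_le` — a polynomial in `V` variables of total degree `≤ D` has at
  most `(D+1)^V` monomials;
* `card_support_sumAlgEquiv_le` — splitting off a block of variables does not create monomials;
* `card_circuitCoeffSupport_le` — hence `t ≤ 2 · (2^{3s}+1)^{n·n + 4s + 1}` generators;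
* `natAbs_coeff_le_weight`, `weight_perPoly_le` — `|g_α| ≤ wt(per_n) ≤ n!`;
* `complexity_perPoly_le_factorial` — `L(per_n) ≤ n! · (n + 1)` over any commutative ring (the
  trivial circuit, used only for the finitely many `n` below the threshold of `ShatteringExclusion`).

Honest framing: bookkeeping for a conditional route (its cruxes `ShatteringExclusion`,
`GoodReduction`, `TameResolution` and `P^#P ⊄ P/poly` are open); `VP ≠ VNP` is NOT proved.

## References

* P. Bürgisser, *Cook's versus Valiant's hypothesis*, TCS 235 (2000), Lemma 2.4 p. 77 and §5 (A3)
  p. 85 (degree/weight of the skeleton; the coefficient system). [cite: Burgisser2000TCS, §5 (A3)]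
-/

-- the summit and the problem share the name `ValiantsHypothesis` (D-0017 single-conjunct layout)
set_option linter.dupNamespace false

noncomputable section

open MvPolynomial

namespace Summit.ValiantsHypothesis.ValiantsHypothesis.Theorems.LangWeilTransfer

open Literature.Computability.AlgebraicComplexity ArithCircuit

/-! ### Counting monomials -/

/-- A polynomial in finitely many variables of total degree `≤ D` has at most `(D+1)^V` monomials,
`V` the number of variables (every exponent is `≤ D`). [folklore] -/
theorem card_support_le_of_totalDegree_le {σ R : Type*} [CommSemiring R] [Fintype σ]
    (f : MvPolynomial σ R) {D : ℕ} (hD : f.totalDegree ≤ D) :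
    f.support.card ≤ (D + 1) ^ Fintype.card σ := by
  classical
  have hle : ∀ m ∈ f.support, ∀ i, m i ≤ D := fun m hm i =>
    ((degreeOf_le_iff.1 le_rfl m hm).trans (degreeOf_le_totalDegree f i)).trans hD
  let e : (σ →₀ ℕ) → (σ → Fin (D + 1)) := fun m i => ⟨min (m i) D, by omega⟩
  calc f.support.card ≤ (Finset.univ : Finset (σ → Fin (D + 1))).card := by
        refine Finset.card_le_card_of_injOn e (fun _ _ => Finset.mem_coe.2 (Finset.mem_univ _)) ?_
        intro m hm m' hm' h
        ext i
        have h1 := hle m hm i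
        have h2 := hle m' hm' i
        have := congrArg (fun g : σ → Fin (D + 1) => ((g i : Fin (D + 1)) : ℕ)) h
        simp only [e] at this
        omega
    _ = (D + 1) ^ Fintype.card σ := by simp

/-- Splitting the variables into two blocks, the support in the first block is the image of the
support under restriction; in particular it is not larger. [folklore] -/
theorem card_support_sumAlgEquiv_le {R : Type*} [CommSemiring R] {τ π : Type*} [DecidableEq τ]
    (F : MvPolynomial (τ ⊕ π) R) :
    (sumAlgEquiv R τ π F).support.card ≤ F.support.card := by
  classical
  -- every `α` in the support of `F` viewed in `X` comes from some monomial `(α, β)` of `F`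
  have key : ∀ α ∈ (sumAlgEquiv R τ π F).support,
      ∃ m ∈ F.support, m.comapDomain Sum.inl Sum.inl_injective.injOn = α := by
    intro α hα
    rw [mem_support_iff] at hα
    obtain ⟨β, hβ⟩ : ∃ β, coeff β (coeff α (sumAlgEquiv R τ π F)) ≠ 0 := by
      by_contra h
      push Not at h
      exact hα (MvPolynomial.ext _ _ fun β => by simpa using h β)
    rw [coeff_coeff_sumAlgEquiv] at hβ
    refine ⟨_, mem_support_iff.2 hβ, ?_⟩
    ext i
    simp
  calc (sumAlgEquiv R τ π F).support.card
      ≤ (F.support.image fun m => m.comapDomain Sum.inl Sum.inl_injective.injOn).card := by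
        refine Finset.card_le_card fun α hα => ?_
        obtain ⟨m, hm, rfl⟩ := key α hα
        exact Finset.mem_image_of_mem _ hm
    _ ≤ F.support.card := Finset.card_image_le

/-- **Number of coefficient identities.** For a fan-in-two circuit `P` with `s` gates over
`n × n` variables and the target `per_n`, the finite generating set `circuitCoeffSupport P per_n`
has at most `(2^{3s}+1)^{n·n+4s+1} + (n+1)^{n·n}` elements. [cite: Burgisser2000TCS, §5 (A3)] -/
theorem card_circuitCoeffSupport_le {k : Type*} [CommRing k] {n : ℕ}
    (P : ArithCircuit k (Fin n × Fin n)) :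
    (circuitCoeffSupport P (perPoly (Fin n) ℤ)).card ≤
      (2 ^ (3 * P.size) + 1) ^ (n * n + (4 * P.size + 1)) + (n + 1) ^ (n * n) := by
  classical
  unfold circuitCoeffSupport
  refine (Finset.card_union_le _ _).trans (add_le_add ?_ ?_)
  · refine (card_support_sumAlgEquiv_le _).trans ?_
    have hdeg : (skeleton P).eval.totalDegree ≤ 2 ^ (3 * P.size) := by
      rw [← size_skeleton P]
      exact totalDegree_eval_le_two_pow_size (isFanInTwo_skeleton P)
    refine (card_support_le_of_totalDegree_le _ hdeg).trans (le_of_eq ?_)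
    simp [Fintype.card_sum, Fintype.card_prod, Fintype.card_fin]
  · have hdeg : (perPoly (Fin n) ℤ).totalDegree ≤ n := by
      rw [totalDegree_perPoly_holds (n := Fin n) (k := ℤ)]; simp
    refine (card_support_le_of_totalDegree_le _ hdeg).trans (le_of_eq ?_)
    simp [Fintype.card_prod, Fintype.card_fin]

/-! ### Weights -/

/-- A single coefficient is bounded by the weight. [folklore] -/
theorem natAbs_coeff_le_weight {σ : Type*} (f : MvPolynomial σ ℤ) (α : σ →₀ ℕ) :
    (coeff α f).natAbs ≤ weight f := by
  classical
  by_cases hα : α ∈ f.support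
  · exact Finset.single_le_sum (f := fun m => (f.coeff m).natAbs) (fun _ _ => Nat.zero_le _) hα
  · rw [notMem_support_iff.1 hα]; simp

/-- `wt(per_n) ≤ n!` (in fact equality: `n!` monomials with coefficient `1`). [folklore] -/
theorem weight_perPoly_le (n : ℕ) : weight (perPoly (Fin n) ℤ) ≤ n.factorial := by
  classical
  rw [perPoly, Matrix.permanent]
  refine (weight_finset_sum_le _ _).trans ?_
  calc ∑ σ : Equiv.Perm (Fin n), weight (∏ i, Matrix.mvPolynomialX (Fin n) (Fin n) ℤ (σ i) i)
      ≤ ∑ _σ : Equiv.Perm (Fin n), 1 := Finset.sum_le_sum fun σ _ =>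
        (weight_finset_prod_le _ _).trans (by simp [Matrix.mvPolynomialX])
    _ = n.factorial := by simp [Fintype.card_perm]

/-- Hence every coefficient identity of the skeleton of `P` against `per_n` has weight
`≤ 2^{2^{3s}} + n!`. [cite: Burgisser2000TCS, §5 (A3)] -/
theorem weight_circuitCoeffPoly_perPoly_le {k : Type*} [CommRing k] {n : ℕ}
    (P : ArithCircuit k (Fin n × Fin n)) (α : Fin n × Fin n →₀ ℕ) :
    weight (circuitCoeffPoly P (perPoly (Fin n) ℤ) α) ≤ 2 ^ 2 ^ (3 * P.size) + n.factorial :=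
  (weight_circuitCoeffPoly_le P _ α).trans
    (Nat.add_le_add_left ((natAbs_coeff_le_weight _ α).trans (weight_perPoly_le n)) _)

/-! ### The trivial circuit for the permanent -/

/-- **The trivial circuit**: over any commutative ring, `L(per_n) ≤ n!·(n+1) + n!`
(sum over all permutations of products of `n` variables). [folklore] -/
theorem complexity_perPoly_le_factorial {R : Type*} [CommRing R] (n : ℕ) :
    complexity (perPoly (Fin n) R) ≤ n.factorial * (n + 1) + n.factorial := by
  classical
  rw [perPoly, Matrix.permanent]
  refine (complexity_finset_sum_le _ _).trans ?_
  have hprod : ∀ σ : Equiv.Perm (Fin n),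
      complexity (∏ i, Matrix.mvPolynomialX (Fin n) (Fin n) R (σ i) i) ≤ n + 1 := fun σ => by
    refine (complexity_finset_prod_le _ _).trans ?_
    have h0 : ∀ i : Fin n, complexity (X (σ i, i) : MvPolynomial (Fin n × Fin n) R) = 0 :=
      fun i => complexity_X_holds _
    simp [Matrix.mvPolynomialX, h0]
  calc ∑ σ : Equiv.Perm (Fin n), complexity (∏ i, Matrix.mvPolynomialX (Fin n) (Fin n) R (σ i) i) +
        (Finset.univ : Finset (Equiv.Perm (Fin n))).card
      ≤ ∑ _σ : Equiv.Perm (Fin n), (n + 1) + (Finset.univ : Finset (Equiv.Perm (Fin n))).card :=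
        Nat.add_le_add_right (Finset.sum_le_sum fun σ _ => hprod σ) _
    _ = n.factorial * (n + 1) + n.factorial := by
        simp [Fintype.card_perm, Finset.card_univ]

/-! ### Logarithms -/

/-- `log₂` of the number of generators is polynomial: with `s ≤ S` and `n ≤ S`, `1 ≤ S`,
`log₂ t ≤ (3S+2)·(S·S+4S+1)·2`. We only need SOME explicit polynomial bound. [folklore] -/
theorem log_card_le {t s n : ℕ}
    (ht : t ≤ (2 ^ (3 * s) + 1) ^ (n * n + (4 * s + 1)) + (n + 1) ^ (n * n)) :
    Nat.log 2 t ≤ (3 * s + 1) * (n * n + 4 * s + 1) + n * (n * n) + 1 := by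
  -- `(2^{3s}+1) ≤ 2^{3s+1}` and `n + 1 ≤ 2^n`
  have h1 : (2 ^ (3 * s) + 1) ^ (n * n + (4 * s + 1)) ≤ 2 ^ ((3 * s + 1) * (n * n + 4 * s + 1)) := by
    calc (2 ^ (3 * s) + 1) ^ (n * n + (4 * s + 1)) ≤ (2 ^ (3 * s + 1)) ^ (n * n + (4 * s + 1)) := by
          apply Nat.pow_le_pow_left
          have : 1 ≤ 2 ^ (3 * s) := Nat.one_le_two_pow
          rw [pow_succ]; omega
      _ = 2 ^ ((3 * s + 1) * (n * n + 4 * s + 1)) := by rw [← pow_mul]; ring_nf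
  have h2 : (n + 1) ^ (n * n) ≤ 2 ^ (n * (n * n)) := by
    calc (n + 1) ^ (n * n) ≤ (2 ^ n) ^ (n * n) :=
          Nat.pow_le_pow_left (Nat.succ_le_of_lt n.lt_two_pow_self) _
      _ = 2 ^ (n * (n * n)) := by rw [← pow_mul]
  have h3 : t ≤ 2 ^ ((3 * s + 1) * (n * n + 4 * s + 1) + n * (n * n) + 1) := by
    refine ht.trans ?_
    have ha : 2 ^ ((3 * s + 1) * (n * n + 4 * s + 1)) ≤
        2 ^ ((3 * s + 1) * (n * n + 4 * s + 1) + n * (n * n)) :=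
      Nat.pow_le_pow_right (by norm_num) (Nat.le_add_right _ _)
    have hb : 2 ^ (n * (n * n)) ≤ 2 ^ ((3 * s + 1) * (n * n + 4 * s + 1) + n * (n * n)) :=
      Nat.pow_le_pow_right (by norm_num) (Nat.le_add_left _ _)
    calc (2 ^ (3 * s) + 1) ^ (n * n + (4 * s + 1)) + (n + 1) ^ (n * n)
        ≤ 2 ^ ((3 * s + 1) * (n * n + 4 * s + 1) + n * (n * n)) +
          2 ^ ((3 * s + 1) * (n * n + 4 * s + 1) + n * (n * n)) := add_le_add (h1.trans ha) (h2.trans hb)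
      _ = _ := by rw [pow_succ]; ring
  calc Nat.log 2 t ≤ Nat.log 2 (2 ^ ((3 * s + 1) * (n * n + 4 * s + 1) + n * (n * n) + 1)) :=
        Nat.log_mono_right h3
    _ = _ := Nat.log_pow (by norm_num) _

/-- `log₂ log₂` of the weights is polynomial: `log₂ (log₂ (2^{2^{3s}} + n!)) ≤ 3s + n·n + 1`. [folklore] -/
theorem log_log_weight_le (s n : ℕ) :
    Nat.log 2 (Nat.log 2 (2 ^ 2 ^ (3 * s) + n.factorial)) ≤ 3 * s + n * n + 1 := by
  have hfac : n.factorial ≤ 2 ^ (n * n) := by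
    calc n.factorial ≤ n ^ n := Nat.factorial_le_pow n
      _ ≤ (2 ^ n) ^ n := Nat.pow_le_pow_left (Nat.lt_two_pow_self).le _
      _ = 2 ^ (n * n) := by rw [← pow_mul]
  have h1 : 2 ^ 2 ^ (3 * s) + n.factorial ≤ 2 ^ (2 ^ (3 * s) + n * n + 1) := by
    have ha : 2 ^ 2 ^ (3 * s) ≤ 2 ^ (2 ^ (3 * s) + n * n) :=
      Nat.pow_le_pow_right (by norm_num) (Nat.le_add_right _ _)
    have hb : 2 ^ (n * n) ≤ 2 ^ (2 ^ (3 * s) + n * n) :=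
      Nat.pow_le_pow_right (by norm_num) (Nat.le_add_left _ _)
    calc 2 ^ 2 ^ (3 * s) + n.factorial ≤ 2 ^ (2 ^ (3 * s) + n * n) + 2 ^ (2 ^ (3 * s) + n * n) :=
          add_le_add ha (hfac.trans hb)
      _ = 2 ^ (2 ^ (3 * s) + n * n + 1) := by rw [pow_succ]; ring
  have h2 : Nat.log 2 (2 ^ 2 ^ (3 * s) + n.factorial) ≤ 2 ^ (3 * s) + n * n + 1 :=
    (Nat.log_mono_right h1).trans (le_of_eq (Nat.log_pow (by norm_num) _))
  have h3 : 2 ^ (3 * s) + n * n + 1 ≤ 2 ^ (3 * s + n * n + 1) := by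
    have ha : n * n + 2 ≤ 2 ^ (n * n + 1) := by
      have := (n * n + 1).lt_two_pow_self; omega
    have hb : 2 ^ (3 * s) * 2 ^ (n * n + 1) = 2 ^ (3 * s + n * n + 1) := by rw [← pow_add, ← add_assoc]
    have hc : 1 ≤ 2 ^ (3 * s) := Nat.one_le_two_pow
    have e1 : 2 ^ (3 * s) * (n * n + 2) ≤ 2 ^ (3 * s) * 2 ^ (n * n + 1) :=
      Nat.mul_le_mul_left _ ha
    have e2 : n * n ≤ 2 ^ (3 * s) * (n * n) := Nat.le_mul_of_pos_left _ (by omega)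
    have e3 : 2 ^ (3 * s) * (n * n + 2) = 2 ^ (3 * s) * (n * n) + 2 * 2 ^ (3 * s) := by ring
    rw [← hb]
    omega
  calc Nat.log 2 (Nat.log 2 (2 ^ 2 ^ (3 * s) + n.factorial))
      ≤ Nat.log 2 (2 ^ (3 * s + n * n + 1)) := Nat.log_mono_right (h2.trans h3)
    _ = 3 * s + n * n + 1 := Nat.log_pow (by norm_num) _

end Summit.ValiantsHypothesis.ValiantsHypothesis.Theorems.LangWeilTransfer

end
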